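import Summits.ResolutionOfSingularities.ResolutionOfSingularities.Theorems.HomologicalConductorNoZenoSplitCountInvariance
import Literature.AlgebraicGeometry.Resolution.ExceptionalPointsFinite
import Literature.AlgebraicGeometry.Resolution.ExceptionalCurvePoints
import HarnessLib

/-!
# Crux `NoZenoR` (stmt-ResolutionOfSingularities-19943), slot `stub_L1wCoreF`, seam3 — DESCENT OF THE SPLIT COUNT along a base change

Route `ResolutionOfSingularities/HomologicalConductor`, crux chain W4.4.  OURS (cell res-hironaka; planner res-L0-w44-plan-1 DESK WORD 21
«(seam3-DESC) COUNT DESCENT `HasSplitExcCurveCountLE D′_f m → HasSplitExcCurveCountLE D′ m` → o5»; lead res-L0-w44-lead-1 g9 seam2 INTERFACE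
21:13:10Z); AI-written, weaker than expert review; nothing of the manuscript under review (Hironaka 2017) is used and no Theses declaration
is asserted.  Def-free, `--supports 19943 --as helper`.

ABSTRACT FORM (this file): for a base change `g : Spec R_B → Spec R` of two-dimensional Noetherian local domains such that
(BC-4) the minimal resolution of `R` base-changes to a MINIMAL resolution of `R_B` and (BC-2) with the SAME split count — both kept BY
SIGNATURE, to be discharged by res-L0-w44-stub-2's `isMinimalResolution_pullback_snd_germ` / `…_of_tower` (p569791 / p568188) and
`splitExcCount_pullback_snd` (p546424) on the chart germs `D′ = locPrime (nrm B) 𝔮 → D′_f` of `exists_chartGermData` — the bound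
`N^s(R_B) ≤ m` DESCENDS to `N^s(R) ≤ m`:

* (private copy of stub-3's `excCurvePoints_finite_of_isResolution`, `…SandwichChartData`) — a resolution of a two-dimensional Noetherian local domain has finitely many integral
  exceptional curves (tree `excPoints_finite` + `IsResolution.excCurvePoints_subset_excPoints`);
* two MINIMAL resolutions of the same germ have the same split count — res-L0-w44-stub-2's `splitExcCount_eq_of_isMinimalResolution` /
  `HasSplitExcCurveCountLE.finite_and_le` (`…NoZenoSplitCountInvariance`, p533556), reused by name;
* **`hasSplitExcCurveCountLE_of_baseChange`** — the descent.

References: J. Lipman, Publ. Math. IHÉS 36 (1969), Thm. (4.1) (p. 204), Lemma (16.1) (p. 231) [`Lipman1969`] (context).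
-/

noncomputable section

-- single-problem summit: the doubled namespace component `ResolutionOfSingularities` is forced
set_option linter.dupNamespace false

namespace Summit.ResolutionOfSingularities.ResolutionOfSingularities.Theorems.NoZeno.ExcCount

open CategoryTheory AlgebraicGeometry Limits IsLocalRing
open Literature.AlgebraicGeometry.Resolution

/-- **A resolution of a two-dimensional Noetherian local domain has finitely many integral exceptional curves** (they are maximal
points of the closed fibre, `IsResolution.excCurvePoints_subset_excPoints`, and those are finitely many, `excPoints_finite`).
[cite: Lipman1969, Section 10 (p. 212)] -/
private theorem excCurvePoints_finite_of_isResolution' {T : Type} [CommRing T] [IsNoetherianRing T] [IsDomain T] [IsLocalRing T]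
    (h2 : ringKrullDim T = 2) {X : Scheme.{0}} {π : X ⟶ Spec (.of T)} (hπ : IsResolution π) :
    (excCurvePoints π).Finite := by
  haveI : IsProper π := hπ.isProper
  exact (excPoints_finite π).subset (hπ.excCurvePoints_subset_excPoints h2)

/-- **DESCENT OF THE SPLIT COUNT ALONG A BASE CHANGE (seam3, abstract form).**  Let `g : Spec R_B → Spec R` be a morphism of spectra of
two-dimensional Noetherian local domains, `R` admitting a minimal resolution (`hmin`, e.g. `Lipman1969_4_1` for a rational singularity),
such that the base change of THE minimal resolution of `R` along `g` is a MINIMAL resolution of `R_B` (`hBC4` — minimality ascent, BC-4)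
with the SAME split count (`hBC2` — BC-2).  If `N^s(R_B) ≤ m` then `N^s(R) ≤ m`: the minimal resolution `ρ` of `R` has
`splitExcCount ρ = splitExcCount ρ_B ≤ m` (`N^s(R_B) ≤ m` is read off ANY minimal resolution of `R_B`,
`HasSplitExcCurveCountLE.finite_and_le`). [cite: Lipman1969, Lemma (16.1) (p. 231)] -/
theorem hasSplitExcCurveCountLE_of_baseChange {R RB : Type} [CommRing R] [IsNoetherianRing R] [IsDomain R] [IsLocalRing R]
    [CommRing RB] [IsLocalRing RB] (h2 : ringKrullDim R = 2)
    (g : Spec (.of RB) ⟶ Spec (.of R))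
    (hmin : ∃ (Y : Scheme.{0}) (ρ : Y ⟶ Spec (.of R)), IsMinimalResolution ρ)
    (hBC4 : ∀ {Y : Scheme.{0}} (ρ : Y ⟶ Spec (.of R)), IsMinimalResolution ρ → IsMinimalResolution (pullback.snd ρ g))
    (hBC2 : ∀ {Y : Scheme.{0}} (ρ : Y ⟶ Spec (.of R)), IsMinimalResolution ρ →
      splitExcCount (pullback.snd ρ g) = splitExcCount ρ)
    {m : ℕ} (h : HasSplitExcCurveCountLE RB m) : HasSplitExcCurveCountLE R m := by
  obtain ⟨Y, ρ, hρ⟩ := hmin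
  refine ⟨Y, ρ, hρ, excCurvePoints_finite_of_isResolution' h2 hρ.1, ?_⟩
  rw [← hBC2 ρ hρ]
  exact (h.finite_and_le (hBC4 ρ hρ)).2

/-- Variant with BC-2 stated only as an INEQUALITY `splitExcCount ρ ≤ splitExcCount ρ_B` (the direction the descent uses).
[cite: Lipman1969, Lemma (16.1) (p. 231)] -/
theorem hasSplitExcCurveCountLE_of_baseChange_le {R RB : Type} [CommRing R] [IsNoetherianRing R] [IsDomain R] [IsLocalRing R]
    [CommRing RB] [IsLocalRing RB] (h2 : ringKrullDim R = 2)
    (g : Spec (.of RB) ⟶ Spec (.of R))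
    (hmin : ∃ (Y : Scheme.{0}) (ρ : Y ⟶ Spec (.of R)), IsMinimalResolution ρ)
    (hBC4 : ∀ {Y : Scheme.{0}} (ρ : Y ⟶ Spec (.of R)), IsMinimalResolution ρ → IsMinimalResolution (pullback.snd ρ g))
    (hBC2 : ∀ {Y : Scheme.{0}} (ρ : Y ⟶ Spec (.of R)), IsMinimalResolution ρ →
      splitExcCount ρ ≤ splitExcCount (pullback.snd ρ g))
    {m : ℕ} (h : HasSplitExcCurveCountLE RB m) : HasSplitExcCurveCountLE R m := by
  obtain ⟨Y, ρ, hρ⟩ := hmin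
  refine ⟨Y, ρ, hρ, excCurvePoints_finite_of_isResolution' h2 hρ.1, ?_⟩
  exact (hBC2 ρ hρ).trans (h.finite_and_le (hBC4 ρ hρ)).2

end Summit.ResolutionOfSingularities.ResolutionOfSingularities.Theorems.NoZeno.ExcCount

end
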